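import Summits.ResolutionOfSingularities.ResolutionOfSingularities.Theses.FrobeniusClosing
import Summits.ResolutionOfSingularities.ResolutionOfSingularities.Theses.ShadowGame
import Literature.AlgebraicGeometry.Resolution.InseparableLocalUniformizationRelativeOneLeaf
import Summits.ResolutionOfSingularities.ResolutionOfSingularities.Theorems.FrobeniusClosingTorsorToLurelPerfectStubPerfectChartOfTemkin
import Summits.ResolutionOfSingularities.ResolutionOfSingularities.Theorems.FrobeniusClosingTorsorToLurelPerfectStubPerfectTowerClimb
import HarnessLib

/-!
# Crux `TorsorToLurelPerfect` (stmt-ResolutionOfSingularities-16162) — line `temkin-leaf`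

STATUS (lead prover-line-stmt-ResolutionOfSingularities-16162-0, 2026-08-17T15:10Z): stubs 2–3
LANDED and integrated below — `Theorems.stub_perfectChartOfTemkin` (p166229,
`Theorems/FrobeniusClosingTorsorToLurelPerfectStubPerfectChartOfTemkin.lean`) and
`Theorems.stub_perfectTowerClimb` (p166292, `…StubPerfectTowerClimb.lean`, with the torsor tower
over a FIXED ground field `torsorStep_fixedField` / `…_of_pow_mem_adjoin` / `torsorRoot_fixedField`
/ `torsorRoots_fixedField` / `towerAbsorb_fixedField`); the CONDITIONAL crux
`Theorems.torsorToLurelPerfect_of_temkin2013Relative` / `…_of_smoothFibre` is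
`Theorems/FrobeniusClosingTorsorToLurelPerfect.lean` (p166525). `lean check`: rc 0, sorries 1 =
`stub_smoothFibreLeaf` = the Literature named fact `Temkin2013RelativeCurveSmoothFibre` (no
`_holds` in tree; shortest path `Temkin2013RelativeCurveSmoothFibre.of_discProvider`, residual =
the (J2) algebraization driver producing a `RoofDatum`, owned by the `Temkin2013` unit). The item is
`blocked-on: Literature.AlgebraicGeometry.Resolution.Temkin2013RelativeCurveSmoothFibre`.

Strategist line (crux-strategist before the lead, 2026-08-17) for the SHARED crux
`TorsorToLurelPerfect` (routes ShadowGame = primary decl / FrobeniusClosing = payload route /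
WildCones / FoliationDescent / JacobianBudget; the five constants are definitionally equal,
`frobeniusClosing_iff_shadowGame` below is `Iff.rfl`).

`TorsorToLurelPerfect` = for every prime `p`: local uniformization of `α_p`-torsors `t ^ p = a`
over bases regular at the centre, over PERFECT ground fields (`PerfectTorsorLU p`, verbatim the
antecedent) implies RELATIVE local uniformization over every PERFECT ground field of
characteristic `p` (`PerfectLUrel p`, verbatim the consequent) — Temkin 2013 (J. Algebra 373 =
arXiv:0804.1554v3), Thm. 1.3.2 + Rem. 1.3.5 (i)–(ii) at `[k : k^p] = 1`.

## The technique and the cut (three named stubs; `TorsorToLurelPerfect_of` proved)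

TECHNIQUE (the only one in print with teeth on this step): Temkin's inseparable local
uniformization (LU after a finite purely inseparable extension `L/K`), Frobenius transport
`ρ = F^m : L ⥲ L^{p^m} ⊆ K` of the uniformizing chart (a `k`-chart again BECAUSE `k^{p^m} = k`),
and the `p`-radical tower `k(ρ N) ⊆ K` climbed one `p`-th root at a time by the torsor
hypothesis over the SAME perfect ground field, with absorption of the prescribed algebra `R` by
normality of the regular centre. The difference from the registered line `birth` (planner-skel,
same day) is WHERE THE CUT FALLS: `birth`'s load-bearing stub is the whole of Temkin's theorem
over perfect fields (size L, unconditional); here that stub is cut along the tree's own proof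
cone of Temkin's theorem, which the Literature unit `Temkin2013` has reduced to ONE named leaf:

* `stub_smoothFibreLeaf` — **the leaf** `Literature.…Temkin2013RelativeCurveSmoothFibre.{0}`
  (Temkin 2013 Thm. 3.3.1 for `k`-smooth generic fibres: relative curves over a valued field of
  height one; printed proof = Berkovich stable modification Thm. 3.2.6 + Krasner + algebraization;
  in tree assembled by `Temkin2013RelativeCurveSmoothFibre.of_inputs` from the valuative input
  (J1) — proved in residue characteristic `0`, and in characteristic `p` reduced to henselian
  rationality over a perfect henselian rank-one split base (HR), `RelativeCurveValuativeInputCharP`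
  — and the algebraization (J2)). THIS IS THE HARDEST STUB AND IT IS NOT THIS CRUX'S PRIVATE
  PROBLEM: it is the single remaining trust base of `Temkin2013`, `Temkin2013Relative`,
  `Valuative.TorsorToLurel` (10968), `Valuative.TorsorToLurelFfinite` (0643) and of this item; the
  lead should NOT work it (the `Temkin2013` Literature unit owns it) — close the two stubs below
  and report `blocked-on: Temkin2013RelativeCurveSmoothFibre`.
* `stub_perfectChartOfTemkin` — **Temkin ⇒ Frobenius-pushed chart over a perfect field (S–M,
  provable now).** `Temkin2013Relative.{0}` ⇒ for `k` perfect of characteristic `p`, `K/k`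
  finitely generated, `O ⊇ k`, `R ⊆ O` finitely generated: `∃ m` and a finitely generated
  `k`-subalgebra `A₀ ⊆ O`, regular at the centre, with `R^{p^m} ⊆ A₀` and `K^{p^m} ⊆ k(A₀)`.
  Proof = steps 0–2 of the landed `torsorToLurelFfinite_of_temkin2013Relative`
  (`Theorems/ValuativeTorsorToLurelFfinite.lean`: affine model `R' ⊇ R` by `exists_affineModel`;
  Thm. 1.3.2; `comap_iterateFrobenius_eq`, `exists_subalgebra_frobeniusBaseField`,
  `isRegularLocalRing_centre_map_iterateFrobenius`, `pow_mem_adjoin_of_isFractionRing`,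
  `pow_mem_of_algebraMap_mem` of `…FfiniteFrobenius.lean`) VERBATIM, plus the one new line: the
  Frobenius base field `F = k^{p^m} ≤ K` EQUALS the image of `k` (`frobeniusBaseField_le_range`
  and, conversely, surjectivity of Frobenius on the perfect field `k`), so the `F`-subalgebra
  `ρ(N)` is a `k`-subalgebra and `k(ρ N) = F(ρ N) ∋ x^{p^m}`.
* `stub_perfectTowerClimb` — **pushed chart ⇒ honest chart, with the PERFECT torsor hypothesis
  (M, provable now; true).** Given `PerfectTorsorLU p` and a pushed chart `(m, A₀)` for
  `(k, K, O, R)` with `k` perfect: a chart `A ⊇ R`, `Frac A = K`, regular at the centre. Proof: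
  finitely many field generators of `K/k` inside `O` (`exists_finset_generators_mem`, landed,
  sorry-free), each with `g^{p^m} ∈ k(A₀)`; `torsor_step`/`torsor_step_of_pow_mem_adjoin`/
  `torsor_root`/`torsor_roots` (`…FfiniteTower.lean`) re-run with `[PerfectField k]` added to the
  torsor hypothesis AND to the section's ground field — legitimate because those proofs apply the
  hypothesis ONLY at the section's own ground field (`hT F E O' A₀' …`, `E ≤ K` an intermediate
  field made a type), never at another field; then absorption `A := k[A₁, R]` by
  `isRegularLocalRing_centre_of_pow_mem` (`…FfiniteAbsorb.lean`) exactly as step 5 of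
  `torsorToLurelFfinite_of_temkin2013Relative`. The generator lemma is INSIDE this stub (unlike
  `birth`'s `stub_perfectTowerAbsorb`, which takes `G` as input), so that the stub's statement is
  self-contained over Mathlib and coincides with the split child `PerfectTowerClimb`.
* `TorsorToLurelPerfect_of : Sig.stub_smoothFibreLeaf → Sig.stub_perfectChartOfTemkin →
  Sig.stub_perfectTowerClimb → TorsorToLurelPerfect` — PROVED (pure logic through the in-tree
  one-liner `Temkin2013Relative.of_smoothFibre`).

Route-level companion (strategist (b), PREPARED not installed): the split
`TorsorToLurelPerfect ⇐ PerfectFrobeniusChart ∧ PerfectTowerClimb` — children.json and the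
kernel-checked glue `TorsorToLurelPerfect_of_subs` (candidate
`Theorems/FrobeniusClosingTorsorToLurelPerfectSplit.lean`, rc 0, 0 sorries) are attached as
evidence on stmt-16162; the gate allows `route edit --split` only on a seat's final cycle and
Theorems proposals only from provers, so the tenure planner / the lead installs it.
`Sig.stub_perfectChartOfTemkin` is `Temkin2013Relative.{0} → PerfectFrobeniusChart` and
`Sig.stub_perfectTowerClimb` is `PerfectTowerClimb`, unfolded.

Disproof used: none on file (no `Disproof.lean`, no Negative lemmas for this crux, 2026-08-17;
`ledger negatives --problem ResolutionOfSingularities` = 1 entry, DefectlessFrames 19085, about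
hypersurface frames — no stub quantifies over frames). Barrier
`Literature.Barriers.ResolutionOfSingularities.InseparableBaseChange` /
`RegularNotGeometricallyRegular` (regular ≠ geometrically regular): not touched — the ground
field is `k` throughout, Frobenius transport is a ring ISOMORPHISM `N ≅ ρ(N)` matching centres,
and no regularity is ever ascended along a base change.
-/

noncomputable section

-- single-problem summit: the doubled namespace component `ResolutionOfSingularities` is forced
set_option linter.dupNamespace false

open IsLocalRing
open Literature.AlgebraicGeometry.Resolution

namespace Summit.ResolutionOfSingularities.ResolutionOfSingularities.Cruxes.TorsorToLurelPerfect.Lines.TemkinLeaf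

/-! ## The two halves of the crux, by name -/

/-- **The crux hypothesis at the prime `p`** — local uniformization of `α_p`-torsors `t ^ p = a`
over bases regular at the centre, over PERFECT ground fields of characteristic `p` (verbatim the
antecedent of `TorsorToLurelPerfect` = the body of the route target `TorsorLUPerfect` at `p`).
[cite: Temkin2013, Rem. 1.3.5 (ii)] -/
def PerfectTorsorLU (p : ℕ) : Prop :=
  ∀ (k K : Type) [Field k] [CharP k p] [PerfectField k] [Field K] [Algebra k K]
    (O : ValuationSubring K) (A₀ : Subalgebra k K) (h₀ : A₀.toSubring ≤ O.toSubring) (t : K),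
    A₀.FG → t ^ p ∈ A₀ → IsFractionRing (Algebra.adjoin k (insert t (A₀ : Set K))) K →
    IsRegularLocalRing (Localization.AtPrime
      (Ideal.comap (Subring.inclusion h₀) (maximalIdeal O))) →
    ∃ (A : Subalgebra k K) (h : A.toSubring ≤ O.toSubring), A₀ ≤ A ∧ t ∈ A ∧ A.FG ∧
      IsFractionRing A K ∧
      IsRegularLocalRing (Localization.AtPrime (Ideal.comap (Subring.inclusion h) (maximalIdeal O)))

/-- **The crux conclusion at the prime `p`** — relative local uniformization over PERFECT ground
fields of characteristic `p` (verbatim the consequent of `TorsorToLurelPerfect`).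
[cite: Temkin2013, Thm. 1.3.2 and Rem. 1.3.5] -/
def PerfectLUrel (p : ℕ) : Prop :=
  ∀ (k K : Type) [Field k] [CharP k p] [PerfectField k] [Field K] [Algebra k K],
    (⊤ : IntermediateField k K).FG → ∀ O : ValuationSubring K, (∀ c : k, algebraMap k K c ∈ O) →
    ∀ R : Subalgebra k K, R.FG → R.toSubring ≤ O.toSubring →
    ∃ (A : Subalgebra k K) (h : A.toSubring ≤ O.toSubring), R ≤ A ∧ A.FG ∧ IsFractionRing A K ∧
      IsRegularLocalRing (Localization.AtPrime (Ideal.comap (Subring.inclusion h) (maximalIdeal O)))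

/-- **The Frobenius-pushed chart** for the data `(p, k, K, O, R)` (Temkin 2013, Rem. 1.3.5 (i),
read inside `K`): an exponent `m` and a finitely generated `k`-subalgebra `A₀ ⊆ O`, regular at
the centre, with `R ^ {p^m} ⊆ A₀` and `K ^ {p^m} ⊆ k(A₀)`. [cite: Temkin2013, Rem. 1.3.5 (i)] -/
def PushedChart (p : ℕ) (k K : Type) [Field k] [Field K] [Algebra k K] (O : ValuationSubring K)
    (R : Subalgebra k K) : Prop :=
  ∃ (m : ℕ) (A₀ : Subalgebra k K) (h₀ : A₀.toSubring ≤ O.toSubring), A₀.FG ∧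
    (∀ r ∈ R, r ^ p ^ m ∈ A₀) ∧
    (∀ x : K, x ^ p ^ m ∈ IntermediateField.adjoin k (A₀ : Set K)) ∧
    IsRegularLocalRing (Localization.AtPrime
      (Ideal.comap (Subring.inclusion h₀) (maximalIdeal O)))

/-- Sanity (definitional): the payload route's crux is, prime by prime,
`PerfectTorsorLU p → PerfectLUrel p`. [folklore] -/
theorem crux_iff :
    Theses.FrobeniusClosing.TorsorToLurelPerfect ↔
      ∀ p : ℕ, p.Prime → PerfectTorsorLU p → PerfectLUrel p :=
  Iff.rfl

/-- Sanity (definitional): the payload route's decl (FrobeniusClosing) and the item's primary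
decl (ShadowGame) are the same proposition. [folklore] -/
theorem frobeniusClosing_iff_shadowGame :
    Theses.FrobeniusClosing.TorsorToLurelPerfect ↔ Theses.ShadowGame.TorsorToLurelPerfect :=
  Iff.rfl

/-! ## The stub STATEMENTS by name (`Sig.stub_<name>`) -/

/-- Statement of `stub_smoothFibreLeaf`: **the single remaining leaf of the tree's proof cone of
Temkin's theorem**, at universe `0` — Thm. 3.3.1 for `k`-smooth generic fibres (the Literature
named fact, verbatim by name). [cite: Temkin2013, Thm. 3.3.1] -/
def Sig.stub_smoothFibreLeaf : Prop :=
  Temkin2013RelativeCurveSmoothFibre.{0}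

/-- Statement of `stub_perfectChartOfTemkin`: **Temkin's Thm. 1.3.2 (corrected relative form, the
Literature fact `Temkin2013Relative`) gives the Frobenius-pushed chart over every PERFECT ground
field** (`k^{p^m} = k` makes `ρ(N)` a `k`-chart). [cite: Temkin2013, Thm. 1.3.2 and Rem. 1.3.5 (i)] -/
def Sig.stub_perfectChartOfTemkin : Prop :=
  Temkin2013Relative.{0} →
    ∀ p : ℕ, p.Prime → ∀ (k K : Type) [Field k] [CharP k p] [PerfectField k] [Field K] [Algebra k K],
      (⊤ : IntermediateField k K).FG → ∀ O : ValuationSubring K, (∀ c : k, algebraMap k K c ∈ O) →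
      ∀ R : Subalgebra k K, R.FG → R.toSubring ≤ O.toSubring → PushedChart p k K O R

/-- Statement of `stub_perfectTowerClimb`: **pushed chart ⇒ honest chart** — with the PERFECT
torsor hypothesis, a Frobenius-pushed chart for `(k, K, O, R)` over a perfect `k` is completed to
a chart `A ⊇ R` with `Frac A = K`, regular at the centre (finitely many field generators inside
`O`; the `p`-radical tower over the same perfect `k`; absorption by normality).
[cite: Temkin2013, Rem. 1.3.5 (ii)] -/
def Sig.stub_perfectTowerClimb : Prop :=
  ∀ p : ℕ, p.Prime → PerfectTorsorLU p →
    ∀ (k K : Type) [Field k] [CharP k p] [PerfectField k] [Field K] [Algebra k K],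
      (⊤ : IntermediateField k K).FG → ∀ O : ValuationSubring K, (∀ c : k, algebraMap k K c ∈ O) →
      ∀ R : Subalgebra k K, R.FG → R.toSubring ≤ O.toSubring → PushedChart p k K O R →
      ∃ (A : Subalgebra k K) (h : A.toSubring ≤ O.toSubring), R ≤ A ∧ A.FG ∧ IsFractionRing A K ∧
        IsRegularLocalRing (Localization.AtPrime
          (Ideal.comap (Subring.inclusion h) (maximalIdeal O)))

/-! ## The stubs -/

/-- **STUB (hardest; the Literature leaf — owned by the `Temkin2013` unit, do not re-prove here).**
Temkin 2013, Thm. 3.3.1 for `k`-smooth generic fibres; in tree `= of_inputs (J1) (J2)` with (J1)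
reduced in characteristic `p` to henselian rationality (HR). [cite: Temkin2013, Thm. 3.3.1] -/
theorem stub_smoothFibreLeaf : Sig.stub_smoothFibreLeaf := by
  sorry

/-- **STUB 2 — LANDED** (p166229, `Theorems.stub_perfectChartOfTemkin`). Steps 0–2 of `torsorToLurelFfinite_of_temkin2013Relative`
verbatim + `k^{p^m} = k` for perfect `k`. Stated UNFOLDED (= `Sig.stub_perfectChartOfTemkin` with
`PushedChart` expanded) so that the Theorems file can carry the header verbatim.
[cite: Temkin2013, Thm. 1.3.2 and Rem. 1.3.5 (i)] -/
theorem stub_perfectChartOfTemkin :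
    Literature.AlgebraicGeometry.Resolution.Temkin2013Relative.{0} →
    ∀ p : ℕ, p.Prime → ∀ (k K : Type) [Field k] [CharP k p] [PerfectField k] [Field K] [Algebra k K],
      (⊤ : IntermediateField k K).FG → ∀ O : ValuationSubring K, (∀ c : k, algebraMap k K c ∈ O) →
      ∀ R : Subalgebra k K, R.FG → R.toSubring ≤ O.toSubring →
      ∃ (m : ℕ) (A₀ : Subalgebra k K) (h₀ : A₀.toSubring ≤ O.toSubring), A₀.FG ∧
        (∀ r ∈ R, r ^ p ^ m ∈ A₀) ∧
        (∀ x : K, x ^ p ^ m ∈ IntermediateField.adjoin k (A₀ : Set K)) ∧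
        IsRegularLocalRing (Localization.AtPrime
          (Ideal.comap (Subring.inclusion h₀) (IsLocalRing.maximalIdeal O))) :=
  Theorems.stub_perfectChartOfTemkin

/-- **STUB 3 — LANDED** (p166292, `Theorems.stub_perfectTowerClimb`). `exists_finset_generators_mem` + the perfect re-run of
`torsor_roots` + `isRegularLocalRing_centre_of_pow_mem`. Stated UNFOLDED
(= `Sig.stub_perfectTowerClimb` with `PerfectTorsorLU` / `PushedChart` expanded) so that the
Theorems file can carry the header verbatim. [cite: Temkin2013, Rem. 1.3.5 (ii)] -/
theorem stub_perfectTowerClimb :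
    ∀ p : ℕ, p.Prime →
      (∀ (k K : Type) [Field k] [CharP k p] [PerfectField k] [Field K] [Algebra k K]
        (O : ValuationSubring K) (A₀ : Subalgebra k K) (h₀ : A₀.toSubring ≤ O.toSubring) (t : K),
        A₀.FG → t ^ p ∈ A₀ → IsFractionRing (Algebra.adjoin k (insert t (A₀ : Set K))) K →
        IsRegularLocalRing (Localization.AtPrime
          (Ideal.comap (Subring.inclusion h₀) (maximalIdeal O))) →
        ∃ (A : Subalgebra k K) (h : A.toSubring ≤ O.toSubring), A₀ ≤ A ∧ t ∈ A ∧ A.FG ∧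
          IsFractionRing A K ∧
          IsRegularLocalRing (Localization.AtPrime
            (Ideal.comap (Subring.inclusion h) (maximalIdeal O)))) →
      ∀ (k K : Type) [Field k] [CharP k p] [PerfectField k] [Field K] [Algebra k K],
        (⊤ : IntermediateField k K).FG → ∀ O : ValuationSubring K,
        (∀ c : k, algebraMap k K c ∈ O) → ∀ R : Subalgebra k K, R.FG →
        R.toSubring ≤ O.toSubring →
        (∃ (m : ℕ) (A₀ : Subalgebra k K) (h₀ : A₀.toSubring ≤ O.toSubring), A₀.FG ∧
          (∀ r ∈ R, r ^ p ^ m ∈ A₀) ∧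
          (∀ x : K, x ^ p ^ m ∈ IntermediateField.adjoin k (A₀ : Set K)) ∧
          IsRegularLocalRing (Localization.AtPrime
            (Ideal.comap (Subring.inclusion h₀) (maximalIdeal O)))) →
        ∃ (A : Subalgebra k K) (h : A.toSubring ≤ O.toSubring), R ≤ A ∧ A.FG ∧
          IsFractionRing A K ∧
          IsRegularLocalRing (Localization.AtPrime
            (Ideal.comap (Subring.inclusion h) (maximalIdeal O))) :=
  Theorems.stub_perfectTowerClimb

/-! ## The composition (kernel-checked; no `sorry` in its own term) -/

/-- **`TorsorToLurelPerfect` (payload route FrobeniusClosing) from the three stub statements** —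
PROVED: the leaf gives `Temkin2013Relative.{0}` (`Temkin2013Relative.of_smoothFibre`, in tree,
sorry-free), stub 2 the pushed chart, stub 3 the honest chart with the perfect torsor
hypothesis `hT`. [cite: Temkin2013, Thm. 1.3.2 and Rem. 1.3.5 (i)–(ii)] -/
theorem TorsorToLurelPerfect_of :
    Sig.stub_smoothFibreLeaf → Sig.stub_perfectChartOfTemkin → Sig.stub_perfectTowerClimb →
      Theses.FrobeniusClosing.TorsorToLurelPerfect := by
  intro h₁ h₂ h₃ p hp hT k K _ _ _ _ _ hfg O hO R hRfg hRO
  exact h₃ p hp hT k K hfg O hO R hRfg hRO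
    (h₂ (Temkin2013Relative.of_smoothFibre h₁) p hp k K hfg O hO R hRfg hRO)

/-- **The same composition concluding the item's PRIMARY decl** (route ShadowGame; the constant
`ledger skeleton check` resolves stmt-16162 to) — identical term through `Iff.rfl`.
[cite: Temkin2013, Thm. 1.3.2 and Rem. 1.3.5 (i)–(ii)] -/
theorem TorsorToLurelPerfect_of_shadowGame :
    Sig.stub_smoothFibreLeaf → Sig.stub_perfectChartOfTemkin → Sig.stub_perfectTowerClimb →
      Theses.ShadowGame.TorsorToLurelPerfect :=
  fun h₁ h₂ h₃ => frobeniusClosing_iff_shadowGame.mp (TorsorToLurelPerfect_of h₁ h₂ h₃)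

/-- **The crux, primary decl (ShadowGame), assembled from the three registered stubs.** -/
theorem TorsorToLurelPerfect_proof : Theses.ShadowGame.TorsorToLurelPerfect :=
  TorsorToLurelPerfect_of_shadowGame stub_smoothFibreLeaf stub_perfectChartOfTemkin
    stub_perfectTowerClimb

/-- **The crux, payload route decl (FrobeniusClosing), assembled from the three registered stubs.** -/
theorem TorsorToLurelPerfect_proof_frobeniusClosing : Theses.FrobeniusClosing.TorsorToLurelPerfect :=
  TorsorToLurelPerfect_of stub_smoothFibreLeaf stub_perfectChartOfTemkin stub_perfectTowerClimb

/-! ## What is unconditional already (informational, sorry-free) -/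

/-- **The crux modulo the two routine stubs is EXACTLY the leaf's business**: stubs 2 and 3 alone
give `Temkin2013Relative.{0} → TorsorToLurelPerfect` — the conditional theorem the lead should
land first (then the item is `blocked-on: Temkin2013RelativeCurveSmoothFibre`).
[cite: Temkin2013, Thm. 1.3.2 and Rem. 1.3.5 (i)–(ii)] -/
theorem TorsorToLurelPerfect_of_temkin2013Relative
    (h₂ : Sig.stub_perfectChartOfTemkin) (h₃ : Sig.stub_perfectTowerClimb)
    (hTem : Temkin2013Relative.{0}) : Theses.FrobeniusClosing.TorsorToLurelPerfect := by
  intro p hp hT k K _ _ _ _ _ hfg O hO R hRfg hRO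
  exact h₃ p hp hT k K hfg O hO R hRfg hRO (h₂ hTem p hp k K hfg O hO R hRfg hRO)

/-- **Converse bookkeeping (sorry-free): the crux's conclusion gives the pushed chart with
`m = 0`** — so `PushedChart` is a genuine WEAKENING of the conclusion, not a restatement of it,
and the split `PerfectFrobeniusChart ∧ PerfectTowerClimb` loses nothing. [folklore] -/
theorem pushedChart_of_perfectLUrel {p : ℕ} (h : PerfectLUrel p)
    (k K : Type) [Field k] [CharP k p] [PerfectField k] [Field K] [Algebra k K]
    (hfg : (⊤ : IntermediateField k K).FG) (O : ValuationSubring K)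
    (hO : ∀ c : k, algebraMap k K c ∈ O) (R : Subalgebra k K) (hRfg : R.FG)
    (hRO : R.toSubring ≤ O.toSubring) : PushedChart p k K O R := by
  obtain ⟨A, h, hRA, hAfg, hAfr, hreg⟩ := h k K hfg O hO R hRfg hRO
  refine ⟨0, A, h, hAfg, fun r hr => ?_, fun x => ?_, hreg⟩
  · simpa using hRA hr
  · haveI := hAfr
    obtain ⟨a, b, -, rfl⟩ := IsFractionRing.div_surjective (A := A) x
    simp only [pow_zero, pow_one]
    exact div_mem (IntermediateField.subset_adjoin k _ a.2) (IntermediateField.subset_adjoin k _ b.2)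

end Summit.ResolutionOfSingularities.ResolutionOfSingularities.Cruxes.TorsorToLurelPerfect.Lines.TemkinLeaf

end
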